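import Summits.PneNP.PneNP.Theorems.Sd2BlMachineGreedy
import Summits.PneNP.PneNP.Theorems.SfmBlSigningFP

/-!
# Sign-degree-2 engine, CLOSER part 1 (dictionary-free): the machine's greedy choice IS the pipeline's greedy
# hypothesis (cell pnp-ideate, ROUND-18 item K1'' `SignDeg2Signing.SignDeg2SigningFP`, stage S3)

FRONTIER (range avoidance for sign-degree-≤2 local maps at linear stretch; restricted-model algorithmic
rung); nothing here bears on P vs NP.

Abstract form of `SfmBlMachine.sumF_step_le` / the `hgreedy` discharge of the CAND closer, for the GENERIC loop
`Sd2BlMachine.greedyBitsP pot m` of G5 with an integer potential of the shape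
`pot kk T0 = C₁ · tS kk T0 + C₂ · hS kk T0`: IF the two machine integers are the cylinder sums of two real
functions (`tS kk T0 = Σ_{T ∈ cyl(kk,T0)} trR T`, `hS kk T0 = Σ_{T ∈ cyl(kk,T0)} hat T` — the M3-SEM / M4-SEM
facts, supplied by the dictionary) and the weights are the cross products `C₁ = p₂q₁`, `C₂ = p₁q₂` of two positive
fractions `A₁ = p₁/q₁`, `A₃ = p₂/q₂`, THEN the signing `y = readOut m (greedyBitsP pot m)` satisfies the greedy
hypothesis of `Sd2Bl.legBound_of_pipeline` for `F T = trR T / A₁ + hat T / A₃` (`hgreedy_greedyBitsP`), and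
`readOut` of the machine's bits has the prefix / step bookkeeping (`readOut_greedyBitsP_step`).  Also the real
cast forms of the G3 parameters (`g_params_spec_real`).  No leg system, no dictionary: pure loop bookkeeping.
-/

set_option linter.dupNamespace false -- `Summit.PneNP.PneNP.…`: summit = sub-problem name (D-0017 single-conjunct layout)

namespace Summit.PneNP.PneNP.Theorems.Sd2BlMachine

open Finset Literature.Computability.Complexity
open Summit.PneNP.PneNP.Theorems.SfmBlMachine (getD_append_single)

/-! ## Parameters in real cast form -/

/-- THE SIDE CONDITIONS of `legBound_of_pipeline` for the canonical parameters, with `N` as the real sum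
`|α| + |β|`. -/
theorem g_params_spec_real {Nα Nβ : ℕ} {b j t₀ : ℕ} (hb : b = pB (Nα + Nβ)) (hj : j + 1 = pJ1 (Nα + Nβ))
    (ht : t₀ = pT0 (Nα + Nβ)) :
    ((Nα : ℝ) + Nβ) ≤ 2 ^ b ∧ 2 * 2 ^ (j + 2) + 2 * b ≤ 10 * (t₀ + 1) ∧
      20 * ((Nα : ℝ) + Nβ) ≤ 2 ^ (2 ^ (j + 1)) := by
  obtain ⟨h1, h2, h3⟩ := g_params_spec hb hj ht
  refine ⟨?_, h3, ?_⟩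
  · exact_mod_cast h1
  · exact_mod_cast h2

/-! ## The greedy hypothesis from the loop -/

section Greedy

variable {m : ℕ} (pot : ℕ → List Bool → ℤ)

/-- The bits of the loop read by `readOut`: below `k` they read the `k`-prefix, at `k` the step's new bit; and the
`(k+1)`-prefix is the step applied to the `k`-prefix (with the potential comparison). -/
theorem readOut_greedyBitsP_step (k : ℕ) (hk : k < m) :
    ∃ (acc : List Bool) (b : Bool), acc.length = k ∧
      (greedyBitsP pot m).take (k + 1) = acc ++ [b] ∧
      pot (k + 1) (acc ++ [b]) ≤ pot (k + 1) (acc ++ [!b]) ∧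
      readOut m (greedyBitsP pot m) ⟨k, hk⟩ = b ∧
      ∀ i : Fin m, (i : ℕ) < k → readOut m (greedyBitsP pot m) i = acc.getD i.val false := by
  set bits := greedyBitsP pot m with hbits
  have hlen : bits.length = m := length_greedyBitsP pot m
  set acc := bits.take k with hacc
  have hacc_len : acc.length = k := by rw [hacc, List.length_take, hlen, min_eq_left hk.le]
  obtain ⟨b, hstep, hle⟩ := pot_greedyStepP_le pot acc
  have hpre : bits.take (k + 1) = acc ++ [b] := by rw [← hstep, hacc]; exact greedyBitsP_prefix pot m hk
  rw [hacc_len] at hle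
  refine ⟨acc, b, hacc_len, hpre, hle, ?_, ?_⟩
  · show bits.getD k false = b
    rw [List.getD_eq_getElem _ _ (by rw [hlen]; exact hk)]
    have h1 : (bits.take (k + 1))[k]'(by rw [List.length_take, hlen]; omega) = bits[k] := List.getElem_take
    rw [← h1]
    simp only [hpre, List.getElem_append_right (le_of_eq hacc_len), hacc_len, Nat.sub_self, List.getElem_cons_zero]
  · intro i hi
    show bits.getD i.val false = _
    rw [hacc, List.getD_eq_getElem _ _ (by rw [hlen]; exact i.isLt),
      List.getD_eq_getElem _ _ (by rw [List.length_take, hlen]; omega), List.getElem_take]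

/-- **THE LOOP'S CHOICE SATISFIES THE GREEDY HYPOTHESIS.**  `tS`, `hS` = the machine's two integers as functions
of the prefix, equal to the cylinder sums of `trR`, `hat`; weights `C₁ = p₂q₁`, `C₂ = p₁q₂`; then for
`F = trR/(p₁/q₁) + hat/(p₂/q₂)` and `y = readOut m (greedyBitsP pot m)` with `pot = C₁·tS + C₂·hS`, at every step
the `F`-sum over the cylinder of `y|_{k+1}` is at most the one over the sibling cylinder. -/
theorem sumF_step_le_gen (trR hat : (Fin m → Bool) → ℝ) (tS : ℕ → List Bool → ℤ) (hS : ℕ → List Bool → ℕ)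
    (htr : ∀ kk, kk ≤ m → ∀ T0 : List Bool, (tS kk T0 : ℝ) = ∑ T ∈ (univ : Finset (Fin m → Bool)).filter
      (fun T => ∀ i ∈ univ.filter (fun i : Fin m => (i : ℕ) < kk), T i = T0.getD i.val false), trR T)
    (hhat : ∀ kk, kk ≤ m → ∀ T0 : List Bool, (hS kk T0 : ℝ) = ∑ T ∈ (univ : Finset (Fin m → Bool)).filter
      (fun T => ∀ i ∈ univ.filter (fun i : Fin m => (i : ℕ) < kk), T i = T0.getD i.val false), hat T)
    {p₁ q₁ p₂ q₂ : ℕ} (hp₁ : 0 < p₁) (hq₁ : 0 < q₁) (hp₂ : 0 < p₂) (hq₂ : 0 < q₂) {C₁ C₂ : ℕ}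
    (hC₁ : C₁ = p₂ * q₁) (hC₂ : C₂ = p₁ * q₂)
    (hpot : ∀ kk T0, pot kk T0 = (C₁ : ℤ) * tS kk T0 + (C₂ : ℤ) * (hS kk T0 : ℤ))
    (k : ℕ) (hk : k < m) :
    let y : Fin m → Bool := readOut m (greedyBitsP pot m)
    let F : (Fin m → Bool) → ℝ := fun T => trR T / ((p₁ : ℝ) / q₁) + hat T / ((p₂ : ℝ) / q₂)
    ∑ T ∈ univ.filter (fun T : Fin m → Bool =>
        ∀ i ∈ univ.filter (fun i : Fin m => (i : ℕ) < k + 1), T i = y i), F T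
      ≤ ∑ T ∈ univ.filter (fun T : Fin m → Bool =>
        ∀ i ∈ univ.filter (fun i : Fin m => (i : ℕ) < k + 1),
          T i = Function.update y ⟨k, hk⟩ (!y ⟨k, hk⟩) i), F T := by
  intro y F
  obtain ⟨acc, b, hacc_len, _, hle, hyk, hyi⟩ := readOut_greedyBitsP_step pot k hk
  -- the two cylinders in prefix form
  have hc₁ : (univ.filter fun T : Fin m → Bool => ∀ i ∈ univ.filter (fun i : Fin m => (i : ℕ) < k + 1), T i = y i)
      = univ.filter fun T : Fin m → Bool =>
          ∀ i ∈ univ.filter (fun i : Fin m => (i : ℕ) < k + 1), T i = (acc ++ [b]).getD i.val false := by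
    refine SfmBl.cylinder_congr _ fun i hi => ?_
    rw [mem_filter] at hi
    rw [getD_append_single acc b i.val (by rw [hacc_len]; omega), hacc_len]
    by_cases h : (i : ℕ) < k
    · rw [if_pos h]; exact hyi i h
    · rw [if_neg h]
      have : i = ⟨k, hk⟩ := Fin.ext (by simp only; omega)
      rw [this]; exact hyk
  have hc₂ : (univ.filter fun T : Fin m → Bool => ∀ i ∈ univ.filter (fun i : Fin m => (i : ℕ) < k + 1),
        T i = Function.update y ⟨k, hk⟩ (!y ⟨k, hk⟩) i)
      = univ.filter fun T : Fin m → Bool =>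
          ∀ i ∈ univ.filter (fun i : Fin m => (i : ℕ) < k + 1), T i = (acc ++ [!b]).getD i.val false := by
    refine SfmBl.cylinder_congr _ fun i hi => ?_
    rw [mem_filter] at hi
    rw [getD_append_single acc (!b) i.val (by rw [hacc_len]; omega), hacc_len]
    by_cases h : (i : ℕ) < k
    · rw [if_pos h, Function.update_of_ne (fun he => by rw [he] at h; exact lt_irrefl _ h)]; exact hyi i h
    · rw [if_neg h]
      have : i = ⟨k, hk⟩ := Fin.ext (by simp only; omega)
      rw [this, Function.update_self]
      exact congrArg (fun x => !x) hyk
  rw [hc₁, hc₂]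
  have hkk : k + 1 ≤ m := hk
  -- the sums through the two integers
  have hsum : ∀ T0 : List Bool, ∑ T ∈ univ.filter (fun T : Fin m → Bool =>
        ∀ i ∈ univ.filter (fun i : Fin m => (i : ℕ) < k + 1), T i = T0.getD i.val false), F T
      = ((tS (k + 1) T0 : ℤ) : ℝ) / ((p₁ : ℝ) / q₁) + (((hS (k + 1) T0 : ℕ) : ℤ) : ℝ) / ((p₂ : ℝ) / q₂) := by
    intro T0
    simp only [F]
    rw [Int.cast_natCast, Finset.sum_add_distrib, ← Finset.sum_div, ← Finset.sum_div, htr (k + 1) hkk T0,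
      hhat (k + 1) hkk T0]
  rw [hsum (acc ++ [b]), hsum (acc ++ [!b]), SfmBl.frac_compare_int_iff hp₁ hq₁ hp₂ hq₂]
  have e := hle
  rw [hpot, hpot, hC₁, hC₂] at e
  exact e

/-- **The greedy hypothesis of `Sd2Bl.legBound_of_pipeline` for the loop's signing**, in its exact shape. -/
theorem hgreedy_greedyBitsP (trR hat : (Fin m → Bool) → ℝ) (tS : ℕ → List Bool → ℤ) (hS : ℕ → List Bool → ℕ)
    (htr : ∀ kk, kk ≤ m → ∀ T0 : List Bool, (tS kk T0 : ℝ) = ∑ T ∈ (univ : Finset (Fin m → Bool)).filter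
      (fun T => ∀ i ∈ univ.filter (fun i : Fin m => (i : ℕ) < kk), T i = T0.getD i.val false), trR T)
    (hhat : ∀ kk, kk ≤ m → ∀ T0 : List Bool, (hS kk T0 : ℝ) = ∑ T ∈ (univ : Finset (Fin m → Bool)).filter
      (fun T => ∀ i ∈ univ.filter (fun i : Fin m => (i : ℕ) < kk), T i = T0.getD i.val false), hat T)
    {p₁ q₁ p₂ q₂ : ℕ} (hp₁ : 0 < p₁) (hq₁ : 0 < q₁) (hp₂ : 0 < p₂) (hq₂ : 0 < q₂) {C₁ C₂ : ℕ}
    (hC₁ : C₁ = p₂ * q₁) (hC₂ : C₂ = p₁ * q₂)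
    (hpot : ∀ kk T0, pot kk T0 = (C₁ : ℤ) * tS kk T0 + (C₂ : ℤ) * (hS kk T0 : ℤ))
    (F : (Fin m → Bool) → ℝ) (hF : ∀ T, F T = trR T / ((p₁ : ℝ) / q₁) + hat T / ((p₂ : ℝ) / q₂))
    (k : ℕ) (hk : k < m) :
    ∑ T' ∈ Finset.univ.filter (fun T' : Fin m → Bool =>
        ∀ i : Fin m, (i : ℕ) < k + 1 → T' i = readOut m (greedyBitsP pot m) i), F T'
      ≤ ∑ T' ∈ Finset.univ.filter (fun T' : Fin m → Bool =>
          (∀ i : Fin m, (i : ℕ) < k → T' i = readOut m (greedyBitsP pot m) i) ∧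
            T' ⟨k, hk⟩ ≠ readOut m (greedyBitsP pot m) ⟨k, hk⟩), F T' := by
  have hFfun : F = fun T => trR T / ((p₁ : ℝ) / q₁) + hat T / ((p₂ : ℝ) / q₂) := funext hF
  subst hFfun
  exact SfmBl.greedy_of_cylinder_steps _ _
    (fun k' hk' => sumF_step_le_gen pot trR hat tS hS htr hhat hp₁ hq₁ hp₂ hq₂ hC₁ hC₂ hpot k' hk') k hk

end Greedy

end Summit.PneNP.PneNP.Theorems.Sd2BlMachine
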